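import Summits.ABC.IUTFork.LDHGenuineStepV
import Literature.IUT.LogVolume.TensorPacketContentBounds
import HarnessLib

/-!
# The fork at [IUTchIII] Corollary 3.12 at a GENUINE input, part 1 (skeleton XXVIIc): every summand of `−|log(Θ)|`
# is an exact affine function of ONE lattice content — `log μ̄_{v⃗}(Θ-hull) = −m·log p + log μ̄(hull(log_p(R_I^×)))`

Record-only file (D-0012) of the abc-iut cell (deliverable (a), skeleton seat abc-iut-skel, gen 7); TAKES NO SIDE.
TWIN NOTICE (v2, docstring only): §1 below and the exact formula are the skeleton-side twin of abc-iut-c312-3's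
`Literature/IUT/LogVolume/GenuineLogThetaExactVolume.lean` (p422788, landed FIRST, 2026-08-26 04:55Z) and
`GenuineLogThetaExactVolumeInput.lean` (p424014: `ThetaVolumeInput.negLogThetaNonarch_eq_of_content`,
`exists_contentFamily`, `cor312Of_iff_of_content`), which are the files OF RECORD for the exact content formula and
the content `iff`; distinct fully-qualified names, same mathematics. Kept here for the θ-currency window (§2) that the
companions `ForkGenuineRegimes.lean` (p425602) and `ForkGenuineWindow.lean` consume.
The GLOBAL-ASSEMBLY sequel ("XXVIIc", announced in `HOME/skel/FORK-REAL-MODEL.md` §4/§8) of skeleton XXVI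
(`ForkPacketReal`, p417081), abc-iut-w5-d180's `ForkPacketHullContent` (p420914: at XXVI's objects
`thetaHull e B = hull(p^m·log_p(R_I^×))`, `log μ̄ = −m·log p + log μ̄(hull(log_p(R_I^×)))`) and abc-iut-w5-d082's
`TensorPacketContentBounds` (p421275, XXVIIb: the content window from the [IUTchIV] Prop. 1.2 sandwich). HERE the
same exact formula is read at the objects from which the tree DEFINES [IUTchIII] Cor. 3.12's `−|log(Θ)|` for a
GENUINE Θ-volume input `I : ThetaVolumeInput F₀ K` (abc-iut-S7/c312-3's `GenuineLogTheta.lean`: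
`negLogThetaNonarch I = Σ_{p ∈ T(I)} ln ν̄_{𝕃_p}(hull of the possible images of O_𝕃(−P_Θ)_p)` over the REAL packets
`realPrimePacketM` of the genuine completions `K_{v̲}` — SHARP (Ind3), full (Ind1)/(Ind2), Mochizuki's container
`p^{−⌈d_I+a_I⌉}·log_p(R_I^×)` as shell — and `Cor312Of I : −deĝ̲(P_q) ≤ negLogThetaNonarch I + ((l+5)/4)·log π`,
never asserted). Dupuy–Hilado, arXiv:2004.13228 (pre-split text, read on the page): Def. 3.6.3 (`𝕃 = Π_p 𝕃_p`),
§3.7 (action through a tensor factor), §3.9 (`O_𝕃(−D)`), §4.7 ("the action of Ind1 on `𝔸^{⊗ j+1}_{V̲,p}` is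
simultaneous"), §4.9 (`p`-adic Ind2: "the measure of sets are preserved"), §4.11
(`U_Θ := Ind2(Ind1((O_𝕃(−P_Θ))^{Ind3}))`), §4.12 ("The hull construction repairs this by taking the smallest possible
module containing this regions"); [IUTchIV] Prop. 1.2 (ii) (kurims `paper:url-56bcb0f95768` p. 10).

PROVED (§1 for ANY shell normalisation `realPrimePacketWith p 𝔽 c …`; §2 for the input's packets; `j = i+1`):
* `indOneUnion_pilotRegion_eq` — the (Ind1)-union of the bare Θ-regions at `v⃗ ∈ V(F)_p^{j+1}` IS the slot-union
  `⋃_a ι_a(t_{Θ,j,v_a})·(R_I)^∼` (§3.9 twists through the last factor, §4.7 permutes the factors; slot `a = σ(j)` for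
  the transposition `σ = (a j)`);
* `possibleImagesHull_pilotRegion_eq` — the `v⃗`-component of the hull of the possible images of `O_𝕃(−P_Θ)` is the
  hull of the (Ind2)-orbit of the slot-union;
* **`exists_content_possibleImagesHull`** — it is admissible with `log μ̄ = −m·log p + log μ̄(hull(log_p(R_I^×)))` for
  the content `m` of the slot-union w.r.t. `Λ = log_p(R_I^×)` (`⊆ p^m·Λ`, `⊄ p^{m+1}·Λ`): with the full (Ind2) group
  the Θ-side of Cor. 3.12 sees the data at `v⃗` ONLY through one integer;
* the WINDOW: `log‖t_{Θ,j,v_a}‖ ≤ log μ̄(Θ-hull)` for EVERY slot `a` (`log_norm_le_logμ_possibleImagesHull`: free, the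
  bare region lies in its hull) and `log μ̄(Θ-hull) ≤ log‖t_{Θ,j,v_{a₀}}‖ + {d_I + a_I + 1}·log p + log μ̄(hull(log_p(R_I^×)))`
  for a slot `a₀` of largest norm (`logμ_possibleImagesHull_le`: [IUTchIV] Prop. 1.2 (ii) at `φ = id` through
  w5-d082's `packetLogμ_packetHull_orbit_le`, rounding absorbed);
* §2 for the input `I` at a prime `p`: `negLogThetaLoc_eq_sum` (Def. 3.6.3 unfolded:
  `(1/ℓ⋇)·Σ_j Σ_{v⃗} log μ̄_{v⃗}(Θ-hull)·Π_k Pr(v_k)`), `log_norm_tΘ` (`log‖t_{Θ,j,v}‖ = −θ_j(v)`,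
  `θ_j(v) := P_{Θ,j}(v)·ln|κ(v)|/n_v`), and the window in θ-currency `neg_thetaMin_le_logμ` / `logμ_le_window`:
  `−min_a θ_j(v_a) ≤ log μ̄_{v⃗}(Θ-hull) ≤ −min_a θ_j(v_a) + {d_I + a_I + 1}·log p + log μ̄(hull(log_p(R_I^×)))`.
The global window for `negLogThetaNonarch I` is the companion `ForkGenuineWindow.lean`; the two regimes (shallow:
Cor. 3.12 HOLDS at the input by arithmetic alone; deep: a Szpiro-type necessary condition, the contents decide in
between) are `ForkGenuineRegimes.lean`; the exact global formula is c312-3's `cor312Of_iff_of_content` (above).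

HONEST SCOPE. Theorems about the tree's typed objects at GENUINE inputs with the SHARP (Ind3)-datum (planner ruling
R6-b; with Dupuy–Hilado's log-shell enlargement `(O_𝕃(−P_Θ))^{Ind3} ⊆ t·𝓘` the contents shift by the shell index,
shapes unchanged) and the FULL (Ind2) group `Aut_{ℚ_p}(⊗K_{v̲_i} : log_p(R_I^×))` of the real packet;
`log μ̄(hull(log_p(R_I^×)))` is left as a term ([IUTchIV] Prop. 1.4 (iii) bookkeeping). (Ind1)/(Ind2)/(Ind3), the
hull and the possible images are the tree's typings of constructions of the disputed corpus [claim: Mochizuki2012,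
status: disputed]; the lattice algebra is classical. Nothing here asserts `Cor312Of` for any input or takes a side on
[IUTchIII] Cor. 3.12; typed ≠ proved. PROOF-ONLY file: no definitions, no `Prop` facts.
[cite: DupuyHilado2025, Def. 3.6.3, §3.7, §3.9, §4.7, §4.9, §4.11, §4.12] [cite: Mochizuki2012, IUTchIV Prop. 1.2 (ii) p. 10]
-/

noncomputable section

open Set Literature.IUT.LogVolume NumberField IsDedekindDomain
open scoped Pointwise

namespace Summit.ABC.IUTFork.GenuineContent

/-! ## 1. One summand of a real packet (any shell normalisation): the Θ-hull of the BARE Θ-regions -/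

section Summand

variable {F : Type} [Field F] [NumberField F] {p : ℕ} [Fact p.Prime] (𝔽 : LocalFields F p)
variable (c : (j : ℕ) → (Fin (j + 1) → placesOver F p) → ℚ_[p]) (hc0 : ∀ j e, c j e ≠ 0)
  (hcσ : ∀ (j : ℕ) (σ : Equiv.Perm (Fin (j + 1))) (e : Fin (j + 1) → placesOver F p), c j (e ∘ σ) = c j e)
variable {lstar : ℕ} (t : Fin lstar → (v : placesOver F p) → (𝔽.k v)ˣ) (i : Fin lstar)
  (e : Fin ((i : ℕ) + 1 + 1) → placesOver F p)

/-- **The (Ind1)-union of the bare Θ-regions at `v⃗` is the SLOT-UNION `⋃_a ι_a(t_{j,v_a})·O_{v⃗}`**: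
`⋃_σ perm_σ(t_{j,v_{σ(j)}}·O_{v⃗∘σ}) = ⋃_{a} ι_a(t_{j,v_a})·(R_I)^∼` (Dupuy–Hilado §3.9 twists through the last
factor, §4.7 (Ind1) moves the factors; every slot `a` is `σ(j)` for the transposition `σ = (a j)`).
[cite: DupuyHilado2025, §3.9, §4.7] -/
theorem indOneUnion_pilotRegion_eq :
    (⋃ σ : Equiv.Perm (Fin ((i : ℕ) + 1 + 1)),
        ((realPrimePacketWith p 𝔽 c hc0 hcσ).perm σ e ''
          (realPrimePacketWith p 𝔽 c hc0 hcσ).pilotRegion t ((i : ℕ) + 1) (e ∘ σ) :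
            Set (PacketAlgebra p (fun b => 𝔽.k (e b))))) =
      ⋃ a : Fin ((i : ℕ) + 1 + 1), iota p (fun b => 𝔽.k (e b)) a (t i (e a) : 𝔽.k (e a)) •
        (normalizedPacket p (fun b => 𝔽.k (e b)) : Set (PacketAlgebra p (fun b => 𝔽.k (e b)))) := by
  have key : ∀ (σ : Equiv.Perm (Fin ((i : ℕ) + 1 + 1))) (a : Fin ((i : ℕ) + 1 + 1)), σ (Fin.last _) = a →
      ((realPrimePacketWith p 𝔽 c hc0 hcσ).perm σ e ''
          (realPrimePacketWith p 𝔽 c hc0 hcσ).pilotRegion t ((i : ℕ) + 1) (e ∘ σ) :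
            Set (PacketAlgebra p (fun b => 𝔽.k (e b)))) =
        iota p (fun b => 𝔽.k (e b)) a (t i (e a) : 𝔽.k (e a)) •
          (normalizedPacket p (fun b => 𝔽.k (e b)) : Set (PacketAlgebra p (fun b => 𝔽.k (e b)))) := by
    rintro σ a rfl
    rw [← PrimePacket.regionOf_eq_pilotRegion, PrimePacket.regionOf_succ_eq]
    exact realPrimePacketWith_perm_image_bare p 𝔽 c hc0 hcσ σ e (t i (e (σ (Fin.last _))))
  apply Set.Subset.antisymm
  · exact Set.iUnion_subset fun σ => (key σ _ rfl).le.trans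
      (Set.subset_iUnion (fun a => iota p (fun b => 𝔽.k (e b)) a (t i (e a) : 𝔽.k (e a)) •
        (normalizedPacket p (fun b => 𝔽.k (e b)) : Set (PacketAlgebra p (fun b => 𝔽.k (e b))))) (σ (Fin.last _)))
  · exact Set.iUnion_subset fun a =>
      (key (Equiv.swap a (Fin.last _)) a (Equiv.swap_apply_right _ _)).ge.trans
        (Set.subset_iUnion (fun σ : Equiv.Perm (Fin ((i : ℕ) + 1 + 1)) =>
          ((realPrimePacketWith p 𝔽 c hc0 hcσ).perm σ e ''
            (realPrimePacketWith p 𝔽 c hc0 hcσ).pilotRegion t ((i : ℕ) + 1) (e ∘ σ) :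
              Set (PacketAlgebra p (fun b => 𝔽.k (e b))))) (Equiv.swap a (Fin.last _)))

/-- **The Θ-hull at `v⃗` of the bare Θ-regions is the hull of the (Ind2)-orbit of the slot-union**:
`hull(⋃_{g,σ} g·perm_σ(t·O)) = hull(⋃_{g ∈ Ind2} g·⋃_a ι_a(t_{j,v_a})·(R_I)^∼)`.
[cite: DupuyHilado2025, §4.7, §4.9, §4.11, §4.12] -/
theorem possibleImagesHull_pilotRegion_eq :
    (realPrimePacketWith p 𝔽 c hc0 hcσ).possibleImagesHull
        ((realPrimePacketWith p 𝔽 c hc0 hcσ).pilotRegion t) ((i : ℕ) + 1) e =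
      packetHull p (fun b => 𝔽.k (e b)) (⋃ γ : indTwo p (fun b => 𝔽.k (e b)),
        γ • ⋃ a : Fin ((i : ℕ) + 1 + 1), iota p (fun b => 𝔽.k (e b)) a (t i (e a) : 𝔽.k (e a)) •
          (normalizedPacket p (fun b => 𝔽.k (e b)) : Set (PacketAlgebra p (fun b => 𝔽.k (e b))))) := by
  show packetHull p (fun b => 𝔽.k (e b))
      (⋃ (γ : indTwo p (fun b => 𝔽.k (e b))) (σ : Equiv.Perm (Fin ((i : ℕ) + 1 + 1))),
        γ • ((realPrimePacketWith p 𝔽 c hc0 hcσ).perm σ e ''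
          (realPrimePacketWith p 𝔽 c hc0 hcσ).pilotRegion t ((i : ℕ) + 1) (e ∘ σ) :
            Set (PacketAlgebra p (fun b => 𝔽.k (e b))))) = _
  rw [← indOneUnion_pilotRegion_eq 𝔽 c hc0 hcσ t i e]
  congr 1
  exact (Set.iUnion_congr fun γ => Set.smul_set_iUnion γ _).symm

/-- The slot-union is bounded (each `ι_a(t)·(R_I)^∼` is a bounded translate). [cite: DupuyHilado2025, §4.12] -/
theorem isPsiBounded_slotUnion :
    IsPsiBounded p (fun b => 𝔽.k (e b))
      (⋃ a : Fin ((i : ℕ) + 1 + 1), iota p (fun b => 𝔽.k (e b)) a (t i (e a) : 𝔽.k (e a)) •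
        (normalizedPacket p (fun b => 𝔽.k (e b)) : Set (PacketAlgebra p (fun b => 𝔽.k (e b))))) :=
  isPsiBounded_iUnion p _ fun _ => isPsiBounded_smul_normalizedPacket p _ _

/-- Every slot's theta value `ι_a(t_{j,v_a}) = ι_a(t_{j,v_a})·1` lies in the slot-union (and is nonzero).
[cite: DupuyHilado2025, §3.7, §4.11] -/
theorem iota_mem_slotUnion (a : Fin ((i : ℕ) + 1 + 1)) :
    iota p (fun b => 𝔽.k (e b)) a (t i (e a) : 𝔽.k (e a)) ∈
      (⋃ a : Fin ((i : ℕ) + 1 + 1), iota p (fun b => 𝔽.k (e b)) a (t i (e a) : 𝔽.k (e a)) •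
        (normalizedPacket p (fun b => 𝔽.k (e b)) : Set (PacketAlgebra p (fun b => 𝔽.k (e b))))) :=
  Set.mem_iUnion.mpr ⟨a, Set.mem_smul_set.mpr ⟨1, Subring.one_mem _, by rw [smul_eq_mul, mul_one]⟩⟩

/-- The slot-union contains a nonzero vector. [cite: DupuyHilado2025, §3.7, §4.11] -/
theorem exists_ne_zero_mem_slotUnion :
    ∃ x ∈ (⋃ a : Fin ((i : ℕ) + 1 + 1), iota p (fun b => 𝔽.k (e b)) a (t i (e a) : 𝔽.k (e a)) •
        (normalizedPacket p (fun b => 𝔽.k (e b)) : Set (PacketAlgebra p (fun b => 𝔽.k (e b))))), x ≠ 0 :=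
  ⟨_, iota_mem_slotUnion 𝔽 t i e (Fin.last _),
    (map_ne_zero (iota p (fun b => 𝔽.k (e b)) (Fin.last _))).mpr (t i (e (Fin.last _))).ne_zero⟩

/-- **EXACT FORMULA at one summand.** For the content `m ∈ ℤ` of the slot-union `⋃_a ι_a(t_{j,v_a})·(R_I)^∼`
w.r.t. the log-shell lattice `Λ = log_p(R_I^×)` (`⊆ p^m·Λ`, `⊄ p^{m+1}·Λ`), the Θ-hull at `v⃗` of the bare
Θ-regions — the `v⃗`-component of "the holomorphic hull of the union of possible images of the Θ-pilot" for the
SHARP (Ind3)-datum and the FULL (Ind2) group — is admissible with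
`log μ̄ = −m·log p + log μ̄(hull(log_p(R_I^×)))` (abc-iut-w5-d180's `exists_packetLogμ_packetHull_orbit_eq` read at
the bare regions). [cite: DupuyHilado2025, §4.9, §4.12] [claim: Mochizuki2012, status: disputed] -/
theorem exists_content_possibleImagesHull :
    ∃ m : ℤ,
      (⋃ a : Fin ((i : ℕ) + 1 + 1), iota p (fun b => 𝔽.k (e b)) a (t i (e a) : 𝔽.k (e a)) •
          (normalizedPacket p (fun b => 𝔽.k (e b)) : Set (PacketAlgebra p (fun b => 𝔽.k (e b))))) ⊆
        ((p : ℚ_[p]) ^ m) • (logPacket p (fun b => 𝔽.k (e b)) : Set (PacketAlgebra p (fun b => 𝔽.k (e b)))) ∧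
      ¬ (⋃ a : Fin ((i : ℕ) + 1 + 1), iota p (fun b => 𝔽.k (e b)) a (t i (e a) : 𝔽.k (e a)) •
          (normalizedPacket p (fun b => 𝔽.k (e b)) : Set (PacketAlgebra p (fun b => 𝔽.k (e b))))) ⊆
        ((p : ℚ_[p]) ^ (m + 1)) •
          (logPacket p (fun b => 𝔽.k (e b)) : Set (PacketAlgebra p (fun b => 𝔽.k (e b)))) ∧
      (realPrimePacketWith p 𝔽 c hc0 hcσ).adm ((realPrimePacketWith p 𝔽 c hc0 hcσ).possibleImagesHull
        ((realPrimePacketWith p 𝔽 c hc0 hcσ).pilotRegion t) ((i : ℕ) + 1) e) ∧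
      (realPrimePacketWith p 𝔽 c hc0 hcσ).logμ ((realPrimePacketWith p 𝔽 c hc0 hcσ).possibleImagesHull
        ((realPrimePacketWith p 𝔽 c hc0 hcσ).pilotRegion t) ((i : ℕ) + 1) e) =
        -(m * Real.log p) + packetLogμ p (fun b => 𝔽.k (e b))
          (packetHull p (fun b => 𝔽.k (e b)) (logPacket p (fun b => 𝔽.k (e b)) : Set _)) := by
  obtain ⟨m, hm, hm1, hadm, hvol⟩ := exists_packetLogμ_packetHull_orbit_eq p (fun b => 𝔽.k (e b))
    (isPsiBounded_slotUnion 𝔽 t i e) (exists_ne_zero_mem_slotUnion 𝔽 t i e)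
  refine ⟨m, hm, hm1, ?_, ?_⟩
  · rw [possibleImagesHull_pilotRegion_eq]
    exact hadm
  · rw [possibleImagesHull_pilotRegion_eq]
    exact hvol

/-- **LOWER end of the window at one summand** (free): every slot's bare Θ-region lies in the Θ-hull, so
`log‖t_{j,v_a}‖ ≤ log μ̄(Θ-hull at v⃗)` for EVERY slot `a` (not only the last one).
[cite: DupuyHilado2025, §3.7, §4.11, §4.12] -/
theorem log_norm_le_logμ_possibleImagesHull (a : Fin ((i : ℕ) + 1 + 1)) :
    Real.log ‖(t i (e a) : 𝔽.k (e a))‖ ≤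
      (realPrimePacketWith p 𝔽 c hc0 hcσ).logμ ((realPrimePacketWith p 𝔽 c hc0 hcσ).possibleImagesHull
        ((realPrimePacketWith p 𝔽 c hc0 hcσ).pilotRegion t) ((i : ℕ) + 1) e) := by
  obtain ⟨m, -, -, hadm, -⟩ := exists_content_possibleImagesHull 𝔽 c hc0 hcσ t i e
  rw [possibleImagesHull_pilotRegion_eq] at hadm ⊢
  have hA : PacketAdm p (fun b => 𝔽.k (e b)) (iota p (fun b => 𝔽.k (e b)) a (t i (e a) : 𝔽.k (e a)) •
      (normalizedPacket p (fun b => 𝔽.k (e b)) : Set (PacketAlgebra p (fun b => 𝔽.k (e b))))) :=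
    packetAdm_iota_smul p (fun b => 𝔽.k (e b)) a (t i (e a)).ne_zero (packetAdm_normalizedPacket p _)
  have hsub : iota p (fun b => 𝔽.k (e b)) a (t i (e a) : 𝔽.k (e a)) •
      (normalizedPacket p (fun b => 𝔽.k (e b)) : Set (PacketAlgebra p (fun b => 𝔽.k (e b)))) ⊆
      packetHull p (fun b => 𝔽.k (e b)) (⋃ γ : indTwo p (fun b => 𝔽.k (e b)),
        γ • ⋃ a : Fin ((i : ℕ) + 1 + 1), iota p (fun b => 𝔽.k (e b)) a (t i (e a) : 𝔽.k (e a)) •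
          (normalizedPacket p (fun b => 𝔽.k (e b)) : Set (PacketAlgebra p (fun b => 𝔽.k (e b))))) := by
    refine (Set.subset_iUnion (fun a : Fin ((i : ℕ) + 1 + 1) => iota p (fun b => 𝔽.k (e b)) a
      (t i (e a) : 𝔽.k (e a)) • (normalizedPacket p (fun b => 𝔽.k (e b)) : Set (PacketAlgebra p (fun b => 𝔽.k (e b))))) a).trans ?_
    refine Set.Subset.trans ?_ (subset_packetHull p (fun b => 𝔽.k (e b)) _)
    refine Set.subset_iUnion_of_subset 1 ?_
    rw [one_smul]
  have h := packetLogμ_mono p (fun b => 𝔽.k (e b)) hA hadm hsub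
  rw [packetLogμ_iota_smul_normalizedPacket p (fun b => 𝔽.k (e b)) a (t i (e a)).ne_zero] at h
  exact h

/-- **UPPER end of the window at one summand** (the [IUTchIV] Prop. 1.2 (ii) route through the content, abc-iut-
w5-d082's `packetLogμ_packetHull_orbit_le`, with the rounding absorbed): for a slot `a₀` of largest norm,
`log μ̄(Θ-hull at v⃗) ≤ log‖t_{j,v_{a₀}}‖ + {d_I + a_I + 1}·log p + log μ̄(hull(log_p(R_I^×)))`.
[cite: Mochizuki2012, IUTchIV Prop. 1.2 (ii) p. 10] [cite: DupuyHilado2025, §4.9, §4.12] -/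
theorem logμ_possibleImagesHull_le (a₀ : Fin ((i : ℕ) + 1 + 1))
    (hmax : ∀ a, ‖(t i (e a) : 𝔽.k (e a))‖ ≤ ‖(t i (e a₀) : 𝔽.k (e a₀))‖) :
    (realPrimePacketWith p 𝔽 c hc0 hcσ).logμ ((realPrimePacketWith p 𝔽 c hc0 hcσ).possibleImagesHull
        ((realPrimePacketWith p 𝔽 c hc0 hcσ).pilotRegion t) ((i : ℕ) + 1) e) ≤
      Real.log ‖(t i (e a₀) : 𝔽.k (e a₀))‖
        + (dSum p (fun b => 𝔽.k (e b)) + aSum p (fun b => 𝔽.k (e b)) + 1) * Real.log p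
        + packetLogμ p (fun b => 𝔽.k (e b))
            (packetHull p (fun b => 𝔽.k (e b)) (logPacket p (fun b => 𝔽.k (e b)) : Set _)) := by
  have hI : 2 ≤ Fintype.card (Fin ((i : ℕ) + 1 + 1)) := by simp
  choose mexp hmexp using fun a => exists_norm_eq_rpow p (𝔽.k (e a)) (t i (e a)).ne_zero
  have hmin : ∀ a, (mexp a₀ : ℝ) / absRamificationIdx p (𝔽.k (e a₀)) ≤
      (mexp a : ℝ) / absRamificationIdx p (𝔽.k (e a)) :=
    fun a => slotOrder_le_of_norm_le p (fun b => 𝔽.k (e b)) (hmexp a) (hmexp a₀) (hmax a)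
  have hle := packetLogμ_packetHull_orbit_le p (fun b => 𝔽.k (e b)) hI (isPsiBounded_slotUnion 𝔽 t i e)
    (exists_ne_zero_mem_slotUnion 𝔽 t i e) (fun a => (t i (e a) : 𝔽.k (e a))) mexp hmexp a₀ hmin Subset.rfl
  have hlog := (slot_ne_zero_and_log_norm p (fun b => 𝔽.k (e b)) (hmexp a₀)).2
  have hp1 : (1 : ℝ) < p := by exact_mod_cast (Fact.out : p.Prime).one_lt
  have hlogp : 0 < Real.log p := Real.log_pos hp1
  have hfloor := Int.lt_floor_add_one ((mexp a₀ : ℝ) / absRamificationIdx p (𝔽.k (e a₀))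
    - dSum p (fun b => 𝔽.k (e b)) - aSum p (fun b => 𝔽.k (e b)))
  have h2 := mul_lt_mul_of_pos_right hfloor hlogp
  rw [possibleImagesHull_pilotRegion_eq]
  show packetLogμ p (fun b => 𝔽.k (e b)) _ ≤ _
  rw [hlog]
  linarith

end Summand

/-! ## 2. The genuine input: `−|log(Θ)|`'s nonarchimedean part as a sum over the real packets -/

section Input

variable {F₀ : Type} [Field F₀] [NumberField F₀] {K : Type} [Field K] [NumberField K] [Algebra F₀ K]
variable (I : ThetaVolumeInput F₀ K)

/-- `negLogThetaLoc p` UNFOLDED at a prime: `(1/ℓ⋇)·Σ_{j=1}^{ℓ⋇} Σ_{v⃗ ∈ V(F₀)_p^{j+1}} log μ̄_{v⃗}(Θ-hull at v⃗)·Π_k Pr(v_k)`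
over the real packet (Mochizuki normalisation) of the genuine completions — Dupuy–Hilado Def. 3.6.3 verbatim.
[cite: DupuyHilado2025, Def. 3.6.3, §4.11–4.12] -/
theorem negLogThetaLoc_eq_sum {p : ℕ} [hp : Fact p.Prime] :
    I.negLogThetaLoc p =
      (1 / (I.X.lstar : ℝ)) * ∑ i : Fin I.X.lstar, ∑ e : Fin ((i : ℕ) + 1 + 1) → placesOver F₀ p,
        (realPrimePacketM p (I.σ.localFieldFamily p hp.out)).logμ
          ((realPrimePacketM p (I.σ.localFieldFamily p hp.out)).possibleImagesHull
            ((realPrimePacketM p (I.σ.localFieldFamily p hp.out)).pilotRegion (I.tΘ p hp.out))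
              ((i : ℕ) + 1) e) * ∏ b, weight F₀ (e b).1 := by
  rw [I.negLogThetaLoc_of_prime hp.out]
  rfl

/-- The theta value of the input at a slot: `log‖t_{Θ,j,v}‖ = −θ_j(v)` with `θ_j(v) := P_{Θ,j}(v)·ln|κ(v)|/n_v`.
[cite: DupuyHilado2025, §3.4, §3.9] -/
theorem log_norm_tΘ {p : ℕ} [hp : Fact p.Prime] (i : Fin I.X.lstar) (v : placesOver F₀ p) :
    Real.log ‖(I.tΘ p hp.out i v : (I.σ.localFieldFamily p hp.out).k v)‖ =
      -(I.X.thetaPilot i v.1 * logNorm F₀ v.1 / localDegree F₀ v.1) :=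
  log_norm_of_ordv_eq (I.σ.localFieldFamily p hp.out) (I.tΘ p hp.out i v) (I.tΘ_ord p hp.out i v)

/-- **LOWER end of the window per summand, for the input**: `−min_a θ_j(v_a) ≤ log μ̄(Θ-hull at v⃗)` (every slot's
bare Θ-region lies in the hull — the free inequality, sharpened by the (Ind1)-slot term).
[cite: DupuyHilado2025, §4.10–4.12] -/
theorem neg_thetaMin_le_logμ {p : ℕ} [hp : Fact p.Prime] (i : Fin I.X.lstar)
    (e : Fin ((i : ℕ) + 1 + 1) → placesOver F₀ p) :
    -(Finset.univ.inf' ⟨0, Finset.mem_univ _⟩ (fun a =>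
        I.X.thetaPilot i (e a).1 * logNorm F₀ (e a).1 / localDegree F₀ (e a).1)) ≤
      (realPrimePacketM p (I.σ.localFieldFamily p hp.out)).logμ
        ((realPrimePacketM p (I.σ.localFieldFamily p hp.out)).possibleImagesHull
          ((realPrimePacketM p (I.σ.localFieldFamily p hp.out)).pilotRegion (I.tΘ p hp.out))
            ((i : ℕ) + 1) e) := by
  obtain ⟨a₀, -, ha₀⟩ := Finset.exists_mem_eq_inf' (⟨0, Finset.mem_univ _⟩ : (Finset.univ :
    Finset (Fin ((i : ℕ) + 1 + 1))).Nonempty)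
    (fun a => I.X.thetaPilot i (e a).1 * logNorm F₀ (e a).1 / localDegree F₀ (e a).1)
  have h : Real.log ‖(I.tΘ p hp.out i (e a₀) : (I.σ.localFieldFamily p hp.out).k (e a₀))‖ ≤
      (realPrimePacketM p (I.σ.localFieldFamily p hp.out)).logμ
        ((realPrimePacketM p (I.σ.localFieldFamily p hp.out)).possibleImagesHull
          ((realPrimePacketM p (I.σ.localFieldFamily p hp.out)).pilotRegion (I.tΘ p hp.out))
            ((i : ℕ) + 1) e) :=
    log_norm_le_logμ_possibleImagesHull (I.σ.localFieldFamily p hp.out) (mScale p _) (mScale_ne_zero p _)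
      (mScale_perm p _) (I.tΘ p hp.out) i e a₀
  rw [log_norm_tΘ] at h
  rw [ha₀]
  exact h

/-- **UPPER end of the window per summand, for the input**: `log μ̄(Θ-hull at v⃗) ≤ −min_a θ_j(v_a) + {d_I + a_I + 1}·log p
+ log μ̄(hull(log_p(R_I^×)))` (the content route). [cite: Mochizuki2012, IUTchIV Prop. 1.2 (ii) p. 10]
[cite: DupuyHilado2025, §4.9, §4.12] -/
theorem logμ_le_window {p : ℕ} [hp : Fact p.Prime] (i : Fin I.X.lstar)
    (e : Fin ((i : ℕ) + 1 + 1) → placesOver F₀ p) :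
    (realPrimePacketM p (I.σ.localFieldFamily p hp.out)).logμ
        ((realPrimePacketM p (I.σ.localFieldFamily p hp.out)).possibleImagesHull
          ((realPrimePacketM p (I.σ.localFieldFamily p hp.out)).pilotRegion (I.tΘ p hp.out))
            ((i : ℕ) + 1) e) ≤
      -(Finset.univ.inf' ⟨0, Finset.mem_univ _⟩ (fun a =>
          I.X.thetaPilot i (e a).1 * logNorm F₀ (e a).1 / localDegree F₀ (e a).1))
        + (dSum p (fun b => (I.σ.localFieldFamily p hp.out).k (e b))
            + aSum p (fun b => (I.σ.localFieldFamily p hp.out).k (e b)) + 1) * Real.log p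
        + packetLogμ p (fun b => (I.σ.localFieldFamily p hp.out).k (e b))
            (packetHull p (fun b => (I.σ.localFieldFamily p hp.out).k (e b))
              (logPacket p (fun b => (I.σ.localFieldFamily p hp.out).k (e b)) : Set _)) := by
  obtain ⟨a₀, -, ha₀⟩ := Finset.exists_mem_eq_inf' (⟨0, Finset.mem_univ _⟩ : (Finset.univ :
    Finset (Fin ((i : ℕ) + 1 + 1))).Nonempty)
    (fun a => I.X.thetaPilot i (e a).1 * logNorm F₀ (e a).1 / localDegree F₀ (e a).1)
  have hmin : ∀ a, I.X.thetaPilot i (e a₀).1 * logNorm F₀ (e a₀).1 / localDegree F₀ (e a₀).1 ≤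
      I.X.thetaPilot i (e a).1 * logNorm F₀ (e a).1 / localDegree F₀ (e a).1 := fun a => by
    rw [← ha₀]
    exact Finset.inf'_le _ (Finset.mem_univ a)
  have hmax : ∀ a, ‖(I.tΘ p hp.out i (e a) : (I.σ.localFieldFamily p hp.out).k (e a))‖ ≤
      ‖(I.tΘ p hp.out i (e a₀) : (I.σ.localFieldFamily p hp.out).k (e a₀))‖ := by
    intro a
    rw [← Real.log_le_log_iff (norm_pos_iff.mpr (I.tΘ p hp.out i (e a)).ne_zero)
      (norm_pos_iff.mpr (I.tΘ p hp.out i (e a₀)).ne_zero), log_norm_tΘ, log_norm_tΘ]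
    exact neg_le_neg (hmin a)
  have h : (realPrimePacketM p (I.σ.localFieldFamily p hp.out)).logμ
        ((realPrimePacketM p (I.σ.localFieldFamily p hp.out)).possibleImagesHull
          ((realPrimePacketM p (I.σ.localFieldFamily p hp.out)).pilotRegion (I.tΘ p hp.out))
            ((i : ℕ) + 1) e) ≤
      Real.log ‖(I.tΘ p hp.out i (e a₀) : (I.σ.localFieldFamily p hp.out).k (e a₀))‖
        + (dSum p (fun b => (I.σ.localFieldFamily p hp.out).k (e b))
            + aSum p (fun b => (I.σ.localFieldFamily p hp.out).k (e b)) + 1) * Real.log p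
        + packetLogμ p (fun b => (I.σ.localFieldFamily p hp.out).k (e b))
            (packetHull p (fun b => (I.σ.localFieldFamily p hp.out).k (e b))
              (logPacket p (fun b => (I.σ.localFieldFamily p hp.out).k (e b)) : Set _)) :=
    logμ_possibleImagesHull_le (I.σ.localFieldFamily p hp.out) (mScale p _) (mScale_ne_zero p _)
      (mScale_perm p _) (I.tΘ p hp.out) i e a₀ hmax
  rw [log_norm_tΘ] at h
  rw [ha₀]
  exact h

end Input

end Summit.ABC.IUTFork.GenuineContent

end
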